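import Summits.CriticalPhenomena.Ising3DConformalLimit.Theorems.PerfectScreeningSubharmonicOffOriginPskDefs
import Literature.Probability.LatticeModels.LatticeDirichletEnergy
import HarnessLib

/-!
# Crux `PerfectScreening.SubharmonicOffOrigin` (stmt-CriticalPhenomena-1341), line `SketchIdeator1`:
# stub `stub_massiveGreen_nonneg` (positivity of the massive lattice Green function of `ℤ³`)

This file proves the registered stub `stub_massiveGreen_nonneg` of the checked skeleton of line
`SketchIdeator1` (planar-source Källén–Lehmann mixture): GIVEN the massive Poisson identity
`(6 + s) G_s(x) − Σᵢ (G_s(x + eᵢ) + G_s(x − eᵢ)) = [x = 0]` (`s ≥ 0`, `x ∈ ℤ³`; a separate stub, taken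
here as the ANTECEDENT), the massive lattice Green function
`G_s = massiveGreen s = ∫_{[-π,π]³} cos (p·x) / (s + 2ε(p)) dp/(2π)³` is nonnegative on `ℤ³` for every
`s ≥ 0`.

## Proof

* `s = 0`: `massiveGreen 0 = latticeGreen / 2` (`massiveGreen_zero`) and `latticeGreen ≥ 0` in `d = 3`
  (`latticeGreen_nonneg`, itself the minimum principle at infinity).
* `s > 0`: (i) DECAY `G_s(x) → 0` as `|x| → ∞` by the Riemann–Lebesgue lemma (Mathlib
  `tendsto_integral_exp_smul_cocompact`, through the functionals `phaseFunctional x` of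
  `LatticeGreenFunction.lean`, exactly as for `tendsto_latticeGreen_cofinite`), the weight
  `1[p ∈ [-π,π]³] / (s + 2ε(p))` being integrable (continuous, on a compact set);
  (ii) MINIMUM PRINCIPLE AT INFINITY on `S = {G_s < 0}`: by the Poisson identity
  `Δ G_s = s G_s − δ₀ ≤ 0` on `S`, `G_s ≥ 0` off `S` by definition, and `G_s → 0` at infinity, so
  `IsZdSuperharmonicOn.ge_of_tendsto` gives `G_s ≥ 0` everywhere.

References: G. F. Lawler, V. Limic, *Random Walk: A Modern Introduction* (2010), §4.2–4.3, §6.1–6.2;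
J. Glimm, A. Jaffe, *Quantum Physics* (1987), §9.5.
-/

noncomputable section

open MeasureTheory Filter Topology Real
open scoped FourierTransform
open Literature.Probability.LatticeModels

namespace Summit.CriticalPhenomena.Ising3DConformalLimit.Theorems.PerfectScreening.Psk

/-! ## Riemann–Lebesgue decay of cosine transforms over the Brillouin zone -/

/-- A cosine transform over the Brillouin zone as the real part of a Fourier integral in Mathlib's
normalisation: `∫_{[-π,π]^d} cos(p·z) g(p) dp = Re ∫ 𝐞(-w_z(p)) • (1[p ∈ [-π,π]^d] g(p)) dp`, for a
weight `g` integrable on `[-π,π]^d`. [folklore] -/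
theorem setIntegral_cos_mul_eq_re {d : ℕ} {g : (Fin d → ℝ) → ℝ}
    (hg : Integrable ((brillouin d).indicator g) volume) (z : Site d) :
    ∫ p in brillouin d, Real.cos (∑ i, p i * (z i : ℝ)) * g p =
      (∫ p, 𝐞 (-(phaseFunctional z p)) • (((brillouin d).indicator g p : ℝ) : ℂ)).re := by
  -- adapted from `setIntegral_cos_div_dispersion_eq_re` (Literature/Probability/LatticeModels/LatticeGreenFunction.lean)
  set G : (Fin d → ℝ) → ℝ := (brillouin d).indicator g with hG
  have hGi : Integrable (fun p => ((G p : ℝ) : ℂ)) volume := hg.ofReal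
  -- the complex integrand and its integrability
  have hint : Integrable (fun p : Fin d → ℝ =>
      Complex.exp (((∑ i, p i * (z i : ℝ) : ℝ) : ℂ) * Complex.I) * ((G p : ℝ) : ℂ)) volume := by
    refine hGi.bdd_mul (c := 1) ?_ (Eventually.of_forall fun p => ?_)
    · exact (Complex.continuous_exp.comp ((Complex.continuous_ofReal.comp (by fun_prop)).mul
        continuous_const)).aestronglyMeasurable
    · rw [Complex.norm_exp_ofReal_mul_I]
  have hsmul : ∀ p : Fin d → ℝ, 𝐞 (-(phaseFunctional z p)) • ((G p : ℝ) : ℂ) =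
      Complex.exp (((∑ i, p i * (z i : ℝ) : ℝ) : ℂ) * Complex.I) * ((G p : ℝ) : ℂ) := fun p => by
    rw [Circle.smul_def, fourierChar_neg_phaseFunctional, smul_eq_mul]
  simp_rw [hsmul]
  have hre := integral_re hint
  simp only [RCLike.re_to_complex] at hre
  rw [← hre]
  simp_rw [Complex.re_mul_ofReal, Complex.exp_ofReal_mul_I_re]
  rw [← integral_indicator (measurableSet_brillouin d)]
  refine integral_congr_ae (Eventually.of_forall fun p => ?_)
  simp only [hG]
  by_cases hp : p ∈ brillouin d
  · simp only [Set.indicator_of_mem hp]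
  · simp only [Set.indicator_of_notMem hp, mul_zero]

/-- **Riemann–Lebesgue on the Brillouin zone**: for a weight `g` integrable on `[-π,π]^d`,
`∫_{[-π,π]^d} cos(p·z) g(p) dp → 0` as `|z| → ∞` in `ℤ^d` (Mathlib
`tendsto_integral_exp_smul_cocompact` composed with `tendsto_phaseFunctional_cocompact`). [folklore] -/
theorem tendsto_setIntegral_cos_mul_cofinite {d : ℕ} {g : (Fin d → ℝ) → ℝ}
    (hg : Integrable ((brillouin d).indicator g) volume) :
    Tendsto (fun z : Site d => ∫ p in brillouin d, Real.cos (∑ i, p i * (z i : ℝ)) * g p)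
      cofinite (𝓝 0) := by
  -- adapted from `tendsto_latticeGreen_cofinite` (Literature/Probability/LatticeModels/LatticeGreenFunction.lean)
  set F : (Fin d → ℝ) → ℂ := fun p => (((brillouin d).indicator g p : ℝ) : ℂ) with hF
  have hRL := (tendsto_integral_exp_smul_cocompact F volume).comp
    (tendsto_phaseFunctional_cocompact d)
  have hre : Tendsto (fun z : Site d => (∫ p, 𝐞 (-(phaseFunctional z p)) • F p).re)
      cofinite (𝓝 0) := by
    have h := (Complex.continuous_re.tendsto 0).comp hRL
    rw [Complex.zero_re] at h
    exact h
  refine hre.congr fun z => ?_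
  rw [setIntegral_cos_mul_eq_re hg z]

/-! ## The massive weight `1 / (s + 2ε)` and the decay of `massiveGreen s` for `s > 0` -/

/-- For `s > 0` the massive weight `p ↦ 1 / (s + 2ε(p))` is continuous (`ε ≥ 0`, so the denominator
is `≥ s > 0`). [folklore] -/
theorem continuous_massiveWeight {d : ℕ} {s : ℝ} (hs : 0 < s) :
    Continuous fun p : Fin d → ℝ => 1 / (s + 2 * dispersion p) := by
  refine continuous_const.div (by have := continuous_dispersion d; fun_prop) fun p => ?_
  have := dispersion_nonneg p
  positivity

/-- For `s > 0` the massive weight, cut off to the Brillouin zone, is integrable on `ℝ^d`. [folklore] -/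
theorem integrable_indicator_massiveWeight {d : ℕ} {s : ℝ} (hs : 0 < s) :
    Integrable ((brillouin d).indicator fun p : Fin d → ℝ => 1 / (s + 2 * dispersion p)) volume :=
  (integrable_indicator_iff (measurableSet_brillouin d)).2
    (integrableOn_brillouin_of_continuous (continuous_massiveWeight hs))

/-- **Decay of the massive lattice Green function**: for `s > 0`, `massiveGreen s z → 0` as `|z| → ∞`
in `ℤ^d` (Riemann–Lebesgue). [folklore] -/
theorem tendsto_massiveGreen_cofinite {d : ℕ} {s : ℝ} (hs : 0 < s) :
    Tendsto (fun z : Site d => massiveGreen s z) cofinite (𝓝 0) := by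
  have h := (tendsto_setIntegral_cos_mul_cofinite (integrable_indicator_massiveWeight (d := d) hs)).div_const
    ((2 * π) ^ d)
  rw [zero_div] at h
  refine h.congr fun z => ?_
  rw [massiveGreen]
  congr 1
  refine integral_congr_ae (Eventually.of_forall fun p => ?_)
  simp only [div_eq_mul_one_div (Real.cos _)]

/-! ## Superharmonicity on the negativity set and the stub -/

/-- From the massive Poisson identity: for `s ≥ 0`, `massiveGreen s` is superharmonic on its negativity
set `{x | massiveGreen s x < 0}` (`Δ G_s = s G_s − δ₀ ≤ 0` there). [folklore] -/
theorem isZdSuperharmonicOn_massiveGreen_neg {s : ℝ} (hs : 0 ≤ s)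
    (hP : ∀ x : Site 3,
      (6 + s) * massiveGreen s x
          - ∑ i : Fin 3, (massiveGreen s (x + Pi.single i 1) + massiveGreen s (x - Pi.single i 1))
        = if x = 0 then 1 else 0) :
    IsZdSuperharmonicOn (massiveGreen (d := 3) s) {x | massiveGreen s x < 0} := by
  intro x hx
  have hx' : massiveGreen s x < 0 := hx
  have key := hP x
  have hδ : (0 : ℝ) ≤ if x = 0 then 1 else 0 := by split_ifs <;> norm_num
  have hsu : s * massiveGreen s x ≤ 0 := mul_nonpos_of_nonneg_of_nonpos hs hx'.le
  rw [latticeLaplacianZd_three]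
  linarith

/-- Stub `stub_massiveGreen_nonneg` of line `SketchIdeator1` (crux `SubharmonicOffOrigin`): GIVEN the
massive Poisson identity `(6 + s) G_s(x) − Σᵢ (G_s(x+eᵢ) + G_s(x−eᵢ)) = [x = 0]` on `ℤ³` for all
`s ≥ 0`, the massive lattice Green function is nonnegative, `0 ≤ massiveGreen s x` (`s ≥ 0`, `x ∈ ℤ³`).
Case `s = 0` is `latticeGreen_nonneg` via `massiveGreen_zero`; for `s > 0`, the minimum principle at
infinity (`IsZdSuperharmonicOn.ge_of_tendsto`) on `{G_s < 0}` with the Riemann–Lebesgue decay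
`tendsto_massiveGreen_cofinite`. [folklore] -/
theorem stub_massiveGreen_nonneg :
    (∀ s : ℝ, 0 ≤ s → ∀ x : Site 3,
      (6 + s) * massiveGreen s x
          - ∑ i : Fin 3, (massiveGreen s (x + Pi.single i 1) + massiveGreen s (x - Pi.single i 1))
        = if x = 0 then 1 else 0) →
    ∀ s : ℝ, 0 ≤ s → ∀ x : Site 3, 0 ≤ massiveGreen s x := by
  intro hP s hs x
  rcases hs.eq_or_lt with h0 | hpos
  · subst h0
    rw [massiveGreen_zero]
    exact div_nonneg (latticeGreen_nonneg 3 (by norm_num) x) zero_le_two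
  · exact (isZdSuperharmonicOn_massiveGreen_neg hs (hP s hs)).ge_of_tendsto (by norm_num) (M := 0)
      (fun y hy => not_lt.1 hy) (tendsto_massiveGreen_cofinite hpos) x

end Summit.CriticalPhenomena.Ising3DConformalLimit.Theorems.PerfectScreening.Psk

end
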